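import Summits.Ventures.Crystal3D.Theorems.StickyWulffConstantPolycrystalWulffBoundRadialMassOuter

/-!
# `PolycrystalWulffBound`, line `PolyDensity`: the RADIAL MASS of the crux's Wulff body inside a ball of
# radius `√3 ≤ R ≤ 2` (eight caps) and the INNER-SHELL lower envelope of the cap profile
# (crux `stmt-Ventures-19482`; input of the generic cdf shift `13/25`, cf-p1 DECISION (lxiv))

Route `StickyWulffConstant` of the venture `Summits/Ventures/Crystal3D`, second prover lane (poly-p2,
gen 16).  Sequel of `…RadialMass` / `…RadialMassOuter` (a fourth radial shell, this time INSIDE radius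
`2`):

* `volume_fccWulffBody_inter_closedBall_ge_of_le_two` / `volume_cruxWulffBody_inter_closedBall_ge_of_le_two` :
  for `√3 ≤ R ≤ 2` and every frame `X`, `|W(X) ∩ B̄(0,R)| ≥ |B̄(0,R)| − 8·cap_R(√3)`,
  `cap_R(τ) = π(2R³/3 − R²τ + τ³/3)` — in cubic coordinates (`W_cubic = {‖y‖_∞ ≤ 2} ∩ {‖y‖₁ ≤ 3}`) a point
  of `B̄(0,R)`, `R ≤ 2`, satisfies the cube constraints automatically, so if it lies outside `W` it
  violates the octahedron constraint, i.e. lies in one of the eight caps `{√3 < ⟪y, s/√3⟫}`; sharp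
  (the caps are disjoint and stay inside their hexagonal facets for `R ≤ 2`).
* `volume_cruxWulffBody_cap_ge_innerShell` : for `√3 ≤ R ≤ 2`, `0 ≤ q ≤ R`, unit `n`:
  `|W(X) ∩ {q < ⟪y,n⟫}| ≥ cap_R(q) − 4·cap_R(√3)` (the ball cap of `B̄(0,R)` minus at most half of the
  centrally symmetric set `B̄(0,R) ∖ W(X)`, whose mass is `≤ 8·cap_R(√3)`).
NUMBERS (memo P-L2-g16): at `R = 7/4` the subtracted constant is `4·cap_{7/4}(√3) = 0.0071`; this one
lower envelope moves the radial-shell certificate of the generic cdf shift from `0.5202` (three shells,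
gen 15) to `0.5072`, enough for `θ = 13/25`; kernel consumer `cruxWulffBody_cap_shift_thirteen_twentyfifths`.
WHAT THIS IS NOT: the sharp constant `√5 − √3`; the crux is not claimed.
-/

noncomputable section

open scoped BigOperators InnerProductSpace ENNReal Pointwise
open MeasureTheory Set

namespace Summit.Ventures.Crystal3D.Theorems

open Summit.Ventures.Crystal3D.Cruxes.TextureLiminf.TexShadow (E3)

open Literature.MathematicalPhysics.StatisticalMechanics (fccStacking fccWulffBody mem_fccWulffBody_iff
  isCompact_fccWulffBody)

/-! ### Eight caps: the mass inside a ball of radius `√3 ≤ R ≤ 2` -/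

/-- In cubic coordinates, for `√3 ≤ R ≤ 2`:
`|W_cubic ∩ B̄(0,R)| ≥ (4/3)πR³ − 8·cap_R(√3)` with `cap_R(τ) = π(2R³/3 − R²τ + τ³/3)`. -/
theorem volume_fccWulffBody_inter_closedBall_ge_of_le_two {R : ℝ} (h3R : Real.sqrt 3 ≤ R) (hR2 : R ≤ 2) :
    ENNReal.ofReal (4 / 3 * Real.pi * R ^ 3 -
        8 * (Real.pi * (2 * R ^ 3 / 3 - R ^ 2 * Real.sqrt 3 + Real.sqrt 3 ^ 3 / 3))) ≤
      volume (fccWulffBody ∩ Metric.closedBall (0 : E3) R) := by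
  have h3pos : 0 < Real.sqrt 3 := Real.sqrt_pos.2 (by norm_num)
  have hRpos : 0 < R := h3pos.trans_le h3R
  have h3sq : Real.sqrt 3 ^ 2 = 3 := Real.sq_sqrt (by norm_num)
  -- the eight octahedron normals `u σ = (±1,±1,±1)/√3`
  set u : (Fin 3 → Bool) → E3 := fun σ =>
    WithLp.toLp 2 fun i => if σ i then (Real.sqrt 3)⁻¹ else -(Real.sqrt 3)⁻¹ with hu
  have huapp : ∀ σ i, u σ i = if σ i then (Real.sqrt 3)⁻¹ else -(Real.sqrt 3)⁻¹ := fun σ i => rfl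
  have husq : ∀ σ i, ‖u σ i‖ ^ 2 = 1 / 3 := by
    intro σ i
    rw [huapp, Real.norm_eq_abs, sq_abs]
    split_ifs
    · rw [inv_pow, h3sq]; norm_num
    · rw [neg_sq, inv_pow, h3sq]; norm_num
  have hunorm : ∀ σ, ‖u σ‖ = 1 := by
    intro σ
    rw [EuclideanSpace.norm_eq, Fin.sum_univ_three, husq, husq, husq]
    norm_num
  -- coordinates are bounded by the norm
  have hcoordle : ∀ (y : E3) (i : Fin 3), |y i| ≤ ‖y‖ := by
    intro y i
    have h1 : ⟪y, EuclideanSpace.single i (1 : ℝ)⟫_ℝ = y i := by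
      rw [EuclideanSpace.inner_single_right]; simp
    have h2 : ‖EuclideanSpace.single i (1 : ℝ)‖ = 1 := by simp
    calc |y i| = |⟪y, EuclideanSpace.single i (1 : ℝ)⟫_ℝ| := by rw [h1]
      _ ≤ ‖y‖ * ‖EuclideanSpace.single i (1 : ℝ)‖ := abs_real_inner_le_norm _ _
      _ = ‖y‖ := by rw [h2, mul_one]
  -- the cover
  set capO : (Fin 3 → Bool) → Set E3 := fun σ =>
    Metric.closedBall (0 : E3) R ∩ {y : E3 | Real.sqrt 3 < ⟪y, u σ⟫_ℝ} with hcapO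
  have hcover : Metric.closedBall (0 : E3) R ⊆
      (fccWulffBody ∩ Metric.closedBall (0 : E3) R) ∪ (⋃ σ, capO σ) := by
    intro y hy
    by_cases hyW : y ∈ fccWulffBody
    · exact Or.inl ⟨hyW, hy⟩
    right
    rw [mem_fccWulffBody_iff] at hyW
    have hynorm : ‖y‖ ≤ R := mem_closedBall_zero_iff.1 hy
    have hcoord : ∀ i, |y i| ≤ 2 := fun i => (hcoordle y i).trans (hynorm.trans hR2)
    have hsum : 3 < ∑ i, |y i| := by
      by_contra hcon
      exact hyW ⟨hcoord, not_lt.1 hcon⟩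
    set σ : Fin 3 → Bool := fun i => decide (0 ≤ y i) with hσ
    have hys : ∀ j, y j * u σ j = (Real.sqrt 3)⁻¹ * |y j| := by
      intro j
      rw [huapp]
      by_cases hj : 0 ≤ y j
      · have : σ j = true := by rw [hσ]; exact decide_eq_true hj
        rw [if_pos this, abs_of_nonneg hj]; ring
      · have : σ j = false := by rw [hσ]; exact decide_eq_false hj
        rw [this, abs_of_neg (lt_of_not_ge hj)]; simp; ring
    have hinner : ⟪y, u σ⟫_ℝ = (Real.sqrt 3)⁻¹ * ∑ j, |y j| := by
      have e1 : ⟪y, u σ⟫_ℝ = y 0 * u σ 0 + y 1 * u σ 1 + y 2 * u σ 2 := by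
        simp [EuclideanSpace.inner_eq_star_dotProduct, dotProduct, Fin.sum_univ_three, mul_comm]
      rw [e1, hys, hys, hys, Fin.sum_univ_three]; ring
    refine mem_iUnion.2 ⟨σ, hy, ?_⟩
    show Real.sqrt 3 < ⟪y, u σ⟫_ℝ
    rw [hinner]
    have e3 : (Real.sqrt 3)⁻¹ * 3 = Real.sqrt 3 := by
      rw [inv_mul_eq_iff_eq_mul₀ h3pos.ne', ← sq, h3sq]
    calc Real.sqrt 3 = (Real.sqrt 3)⁻¹ * 3 := e3.symm
      _ < (Real.sqrt 3)⁻¹ * ∑ j, |y j| := mul_lt_mul_of_pos_left hsum (inv_pos.2 h3pos)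
  -- volumes of the caps
  have hcapOvol : ∀ σ, volume (capO σ) =
      ENNReal.ofReal (Real.pi * (2 * R ^ 3 / 3 - R ^ 2 * Real.sqrt 3 + Real.sqrt 3 ^ 3 / 3)) :=
    fun σ => volume_closedBall_inter_ioi (hunorm σ) hRpos h3R (by linarith)
  have hO0 : 0 ≤ Real.pi * (2 * R ^ 3 / 3 - R ^ 2 * Real.sqrt 3 + Real.sqrt 3 ^ 3 / 3) := by
    have hfac : 2 * R ^ 3 / 3 - R ^ 2 * Real.sqrt 3 + Real.sqrt 3 ^ 3 / 3 =
        (R - Real.sqrt 3) ^ 2 * (2 * R + Real.sqrt 3) / 3 := by ring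
    rw [hfac]
    exact mul_nonneg Real.pi_pos.le (by positivity)
  have hball : volume (Metric.closedBall (0 : E3) R) = ENNReal.ofReal (4 / 3 * Real.pi * R ^ 3) :=
    volume_closedBall_zero_E3 hRpos.le
  have hkey : ENNReal.ofReal (4 / 3 * Real.pi * R ^ 3) ≤
      volume (fccWulffBody ∩ Metric.closedBall (0 : E3) R) +
        ENNReal.ofReal (8 * (Real.pi * (2 * R ^ 3 / 3 - R ^ 2 * Real.sqrt 3 + Real.sqrt 3 ^ 3 / 3))) := by
    calc ENNReal.ofReal (4 / 3 * Real.pi * R ^ 3) = volume (Metric.closedBall (0 : E3) R) := hball.symm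
      _ ≤ volume ((fccWulffBody ∩ Metric.closedBall (0 : E3) R) ∪ (⋃ σ, capO σ)) :=
          measure_mono hcover
      _ ≤ volume (fccWulffBody ∩ Metric.closedBall (0 : E3) R) + volume (⋃ σ, capO σ) :=
          measure_union_le _ _
      _ ≤ volume (fccWulffBody ∩ Metric.closedBall (0 : E3) R) + ∑ σ, volume (capO σ) :=
          add_le_add le_rfl ((measure_iUnion_le _).trans (by rw [tsum_fintype]))
      _ = volume (fccWulffBody ∩ Metric.closedBall (0 : E3) R) +
          ENNReal.ofReal (8 * (Real.pi * (2 * R ^ 3 / 3 - R ^ 2 * Real.sqrt 3 + Real.sqrt 3 ^ 3 / 3))) := by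
          congr 1
          simp_rw [hcapOvol]
          rw [Finset.sum_const, Finset.card_univ, Fintype.card_fun, Fintype.card_bool, Fintype.card_fin]
          simp only [nsmul_eq_mul]
          rw [ENNReal.ofReal_mul (by norm_num : (0:ℝ) ≤ 8)]
          norm_num
  have hsub : ENNReal.ofReal (4 / 3 * Real.pi * R ^ 3 -
        8 * (Real.pi * (2 * R ^ 3 / 3 - R ^ 2 * Real.sqrt 3 + Real.sqrt 3 ^ 3 / 3))) =
      ENNReal.ofReal (4 / 3 * Real.pi * R ^ 3) -
        ENNReal.ofReal (8 * (Real.pi * (2 * R ^ 3 / 3 - R ^ 2 * Real.sqrt 3 + Real.sqrt 3 ^ 3 / 3))) :=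
    ENNReal.ofReal_sub _ (mul_nonneg (by norm_num) hO0)
  rw [hsub]
  exact tsub_le_iff_right.2 hkey

/-- **Mass inside radius `√3 ≤ R ≤ 2`.** For every frame `X`:
`|W(X) ∩ B̄(0,R)| ≥ (4/3)πR³ − 8·cap_R(√3)`. -/
theorem volume_cruxWulffBody_inter_closedBall_ge_of_le_two (X : E3 ≃ₗᵢ[ℝ] E3) {R : ℝ}
    (h3R : Real.sqrt 3 ≤ R) (hR2 : R ≤ 2) :
    ENNReal.ofReal (4 / 3 * Real.pi * R ^ 3 -
        8 * (Real.pi * (2 * R ^ 3 / 3 - R ^ 2 * Real.sqrt 3 + Real.sqrt 3 ^ 3 / 3))) ≤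
      volume ({y : E3 | ∀ ν : E3, ⟪y, ν⟫_ℝ ≤ Real.sqrt 2 / 4 *
        ∑ᶠ w ∈ {w | w ∈ fccStacking 1 (Real.sqrt (2 / 3)) ∧ ‖w‖ = 1}, |⟪w, X.symm ν⟫_ℝ|} ∩
        Metric.closedBall (0 : E3) R) := by
  obtain ⟨L, hL⟩ := exists_linearIsometryEquiv_unitShell_eq
  rw [cruxWulffBody_eq_image_fccWulffBody hL X]
  set Φ : E3 ≃ₗᵢ[ℝ] E3 := L.trans X with hΦ
  have himage : Φ '' fccWulffBody ∩ Metric.closedBall (0 : E3) R =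
      Φ '' (fccWulffBody ∩ Metric.closedBall (0 : E3) R) := by
    ext y
    simp only [mem_inter_iff, mem_image, Metric.mem_closedBall, dist_zero_right]
    constructor
    · rintro ⟨⟨x, hx, rfl⟩, hy⟩
      exact ⟨x, ⟨hx, by rwa [LinearIsometryEquiv.norm_map] at hy⟩, rfl⟩
    · rintro ⟨x, ⟨hx, hx2⟩, rfl⟩
      exact ⟨⟨x, hx, rfl⟩, by rwa [LinearIsometryEquiv.norm_map]⟩
  have hmeas : MeasurableSet (fccWulffBody ∩ Metric.closedBall (0 : E3) R) :=
    isCompact_fccWulffBody.isClosed.measurableSet.inter Metric.isClosed_closedBall.measurableSet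
  rw [himage, LinearIsometryEquiv.image_eq_preimage_symm,
    Φ.symm.measurePreserving.measure_preimage hmeas.nullMeasurableSet]
  exact volume_fccWulffBody_inter_closedBall_ge_of_le_two h3R hR2

/-! ### The inner-shell lower envelope -/

/-- **Inner-shell lower envelope.** For every frame `X`, unit `n`, radius `√3 ≤ R ≤ 2` and
`0 ≤ q ≤ R`: `|W(X) ∩ {q < ⟪y,n⟫}| ≥ cap_R(q) − 4·cap_R(√3)` — the ball cap of `B̄(0,R)` minus at
most half of the centrally symmetric set `B̄(0,R) ∖ W(X)` (mass `≤ 8·cap_R(√3)`). -/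
theorem volume_cruxWulffBody_cap_ge_innerShell (X : E3 ≃ₗᵢ[ℝ] E3) {n : E3} (hn : ‖n‖ = 1) {R q : ℝ}
    (h3R : Real.sqrt 3 ≤ R) (hR2 : R ≤ 2) (hq0 : 0 ≤ q) (hqR : q ≤ R) :
    ENNReal.ofReal (Real.pi * (2 * R ^ 3 / 3 - R ^ 2 * q + q ^ 3 / 3) -
        4 * (Real.pi * (2 * R ^ 3 / 3 - R ^ 2 * Real.sqrt 3 + Real.sqrt 3 ^ 3 / 3))) ≤
      volume ({y : E3 | ∀ ν : E3, ⟪y, ν⟫_ℝ ≤ Real.sqrt 2 / 4 *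
        ∑ᶠ w ∈ {w | w ∈ fccStacking 1 (Real.sqrt (2 / 3)) ∧ ‖w‖ = 1}, |⟪w, X.symm ν⟫_ℝ|} ∩
        {y : E3 | q < ⟪y, n⟫_ℝ}) := by
  set body : Set E3 := {y : E3 | ∀ ν : E3, ⟪y, ν⟫_ℝ ≤ Real.sqrt 2 / 4 *
    ∑ᶠ w ∈ {w | w ∈ fccStacking 1 (Real.sqrt (2 / 3)) ∧ ‖w‖ = 1}, |⟪w, X.symm ν⟫_ℝ|} with hbody
  set c : ℝ := Real.pi * (2 * R ^ 3 / 3 - R ^ 2 * Real.sqrt 3 + Real.sqrt 3 ^ 3 / 3) with hc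
  have h3pos : 0 < Real.sqrt 3 := Real.sqrt_pos.2 (by norm_num)
  have hRpos : 0 < R := h3pos.trans_le h3R
  have hWm : MeasurableSet body := (isCompact_cruxWulffBody X).isClosed.measurableSet
  have hWneg : -body = body := neg_cruxWulffBody_eq X
  set BR : Set E3 := Metric.closedBall (0 : E3) R with hBR
  have hBRm : MeasurableSet BR := Metric.isClosed_closedBall.measurableSet
  have hBRvol : volume BR = ENNReal.ofReal (4 / 3 * Real.pi * R ^ 3) := volume_closedBall_zero_E3 hRpos.le
  set H : Set E3 := {y : E3 | q < ⟪y, n⟫_ℝ} with hH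
  -- the symmetric defect `N = B̄(0,R) ∖ body`
  set N : Set E3 := BR \ body with hN
  have hNm : MeasurableSet N := hBRm.diff hWm
  have hNneg : -N = N := by
    ext y
    simp only [hN, Set.mem_neg, mem_sdiff, hBR, Metric.mem_closedBall, dist_zero_right, norm_neg]
    constructor
    · rintro ⟨hb, hy⟩
      refine ⟨hb, fun h => hy ?_⟩
      have h2 : -y ∈ -body := Set.neg_mem_neg.2 h
      rwa [hWneg] at h2
    · rintro ⟨hb, hy⟩
      refine ⟨hb, fun h => hy ?_⟩
      have h2 : -y ∈ body := h
      rw [← hWneg] at h2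
      exact Set.neg_mem_neg.1 h2
  have hc0 : 0 ≤ c := by
    have hfac : 2 * R ^ 3 / 3 - R ^ 2 * Real.sqrt 3 + Real.sqrt 3 ^ 3 / 3 =
        (R - Real.sqrt 3) ^ 2 * (2 * R + Real.sqrt 3) / 3 := by ring
    rw [hc, hfac]
    exact mul_nonneg Real.pi_pos.le (by positivity)
  -- `|N| ≤ 8c` (in reals, then in `ℝ≥0∞`)
  have hfinBR : volume BR ≠ ⊤ := by rw [hBRvol]; exact ENNReal.ofReal_ne_top
  have hNeq : volume N = volume BR - volume (body ∩ BR) := by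
    have hdiff : N = BR \ (body ∩ BR) := by
      ext y; simp only [hN, mem_sdiff, mem_inter_iff]; tauto
    rw [hdiff, measure_sdiff inter_subset_right (hWm.inter hBRm).nullMeasurableSet
      ((measure_mono inter_subset_right).trans_lt hfinBR.lt_top).ne]
  have hmle : ENNReal.ofReal (4 / 3 * Real.pi * R ^ 3 - 8 * c) ≤ volume (body ∩ BR) :=
    volume_cruxWulffBody_inter_closedBall_ge_of_le_two X h3R hR2
  have hNle : volume N ≤ ENNReal.ofReal (8 * c) := by
    rw [hNeq, hBRvol]
    refine tsub_le_iff_right.2 ?_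
    calc ENNReal.ofReal (4 / 3 * Real.pi * R ^ 3)
        ≤ ENNReal.ofReal ((4 / 3 * Real.pi * R ^ 3 - 8 * c) + 8 * c) := by
          refine ENNReal.ofReal_le_ofReal ?_; linarith
      _ ≤ ENNReal.ofReal (4 / 3 * Real.pi * R ^ 3 - 8 * c) + ENNReal.ofReal (8 * c) :=
          ENNReal.ofReal_add_le
      _ ≤ volume (body ∩ BR) + ENNReal.ofReal (8 * c) := add_le_add hmle le_rfl
      _ = ENNReal.ofReal (8 * c) + volume (body ∩ BR) := add_comm _ _
  -- at most half of `N` lies above the level `q ≥ 0`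
  have hNH : volume (N ∩ H) ≤ ENNReal.ofReal (4 * c) := by
    have h2 := two_mul_volume_inter_ioi_le_of_symm hNneg hNm n hq0
    have h3 : 2 * volume (N ∩ H) ≤ ENNReal.ofReal (8 * c) := h2.trans hNle
    have h4 : ENNReal.ofReal (8 * c) = 2 * ENNReal.ofReal (4 * c) := by
      rw [← ENNReal.ofReal_ofNat 2, ← ENNReal.ofReal_mul (by norm_num : (0:ℝ) ≤ 2)]
      congr 1; ring
    rw [h4] at h3
    exact (ENNReal.mul_le_mul_iff_right (by norm_num) (by norm_num)).1 h3
  -- the ball cap splits into the body cap and the defect cap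
  have hsplit : BR ∩ H ⊆ (body ∩ H) ∪ (N ∩ H) := by
    rintro y ⟨hb, hh⟩
    by_cases hy : y ∈ body
    · exact Or.inl ⟨hy, hh⟩
    · exact Or.inr ⟨⟨hb, hy⟩, hh⟩
  have hcap : volume (BR ∩ H) = ENNReal.ofReal (Real.pi * (2 * R ^ 3 / 3 - R ^ 2 * q + q ^ 3 / 3)) :=
    volume_closedBall_inter_ioi hn hRpos hqR (by linarith)
  have hle : volume (BR ∩ H) ≤ volume (body ∩ H) + volume (N ∩ H) :=
    (measure_mono hsplit).trans (measure_union_le _ _)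
  calc ENNReal.ofReal (Real.pi * (2 * R ^ 3 / 3 - R ^ 2 * q + q ^ 3 / 3) - 4 * c)
      = ENNReal.ofReal (Real.pi * (2 * R ^ 3 / 3 - R ^ 2 * q + q ^ 3 / 3)) - ENNReal.ofReal (4 * c) :=
        ENNReal.ofReal_sub _ (by positivity)
    _ ≤ volume (BR ∩ H) - volume (N ∩ H) := by rw [hcap]; exact tsub_le_tsub_left hNH _
    _ ≤ volume (body ∩ H) := tsub_le_iff_right.2 hle

end Summit.Ventures.Crystal3D.Theorems

end
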